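/-
Copyright: the b2b-balaban cell (near-miss cell 7), T⁴-continuum fan-out; row NE7b ROUND-2 swarm, seat
t4-ne7b-formalise-leaf-03 (row S12 «ASSEMBLY» of `t4/b2b-balaban-t4-ne7b-p1/LEAVES-NE7b.md`; node A12 of the typer's
`t4/formal/NE7b/DAG.md`).  Released under the licence of the surrounding project.
-/
import Summits.QuantumFields.BalabanUV.T4Continuum.Support.HistoryAssemblyTerms
import Summits.QuantumFields.BalabanUV.T4Continuum.Support.HistoryAssemblyTreesLE
import Summits.QuantumFields.BalabanUV.T4Continuum.Support.HistoryCanonLE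

/-!
# History assembly, LE currency: the term reading WITHOUT the renewal-at-reach clause and its END

Summits-side support file of the T⁴-continuum cell (rung (B)+1 on a FINITE torus only; NOT infinite volume, NOT the
mass gap, NOT the Clay statement; NOT a proof of the spine estimate NE7b).  Row S12 «ASSEMBLY» of the ROUND-2 swarm
table `t4/b2b-balaban-t4-ne7b-p1/LEAVES-NE7b.md`, node A12 of the typer's `t4/formal/NE7b/DAG.md`; the typer's
«LE consumer switch», term-keyed layer (the sibling of `HistoryAssemblyTerms` §3–§4 over `HistoryAssemblyTreesLE`).

WHAT.  §1 **`structure TermReadingLE`** = `HistoryAssemblyTerms.TermReading` with the member facts in the LE currency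
of row S4c (leaf-02): `consistent` over `HistoryBankingLE.ConsistentTLE` (renewal at `h + 1 ≤ reach`, NO
renewal-at-reach equality) and `wf : q.2.WF (dictWT sh (R K) C.n₁)` (the dictionary's located well-formedness,
`T4PersistenceDictionary.Gen.WF`) in place of `fresh`; the other six fields (`pending`, `cell_mem`, `chrono`, `fat_lt`,
`fuel_le`, `inj`) verbatim.  The three derived tree-slot binders **`hlabTLE_of_termReadingLE`**,
**`hstr_of_termReadingLE`** (over leaf-02's `HistoryCanonLE.mem_bliveSlots_of_chronoLE` ∕ `mem_boldSlots_of_chronoLE`),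
**`hF_of_priceReadingLE`**.  §2 the END **`hybridNE7_of_termReadingLE_canon`** =
`HistoryAssemblyTerms.hybridNE7_of_termReading_canon` VERBATIM except `H : TermReadingLE …` and
`hir : irThresholdTLE C F.L rr β₀ ≤ log g⁻²`, composed over `HistoryAssemblyTreesLE.hybridNE7_of_treeBinders_canonLE`.
The term data (`badTerms`, `badClasses`, `priceT`, `occ`, `yT`, `bstrOf`) are those of `HistoryAssemblyTerms` ∕
`HistorySocketTH`, unchanged.  [folklore] finite bookkeeping + composition of landed lemmas by name; ONE new
`structure … : Prop` (a hypothesis shape, no `Prop`-valued fact asserted, trigger condition c1); no `[cite:]` tag,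
nothing printed asserted.

HONEST DEPENDENCY (cell): continuum YM on T⁴ ⇐ BetaPertH ∧ nine spine estimates (0/9 proved); BetaPertH ⇐ (D1) ∧ (D4)
∧ CAP+tail.  Nothing of H3 ∕ (B) ∕ BetaPertH is discharged here; NE7b is NOT proved; no date.
-/

open Finset MeasureTheory
open Literature.MathematicalPhysics.QuantumFieldTheory.Balaban1983to89
open T4PersistenceDictionary T4PersistentHistoryCount T4BankedInduction T4PrintedShapeBanking
open T4WeightBudget T4GlobalDenominator T4LiveClassFibration T4LiveStructureGas T4LiveGasToTerms T4RecordPriceSeam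
open T4PartnerMultiplicity T4IndicatorShell T4MatchingAssembly T4MatchingClosure T4MatchingClosureSocket T4Continuum
open T4StabilitySocket T4BranchingRecordsGas T4TaggedShapeBanking T4CanonicalMenus T4RenewalChains
open Summit.QuantumFields.BalabanUV.T4Continuum.PlacementBatch
open Summit.QuantumFields.BalabanUV.T4Continuum.PlacementSkeleton
open Summit.QuantumFields.BalabanUV.T4Continuum.CountThresholdUniform
open Summit.QuantumFields.BalabanUV.T4Continuum.CountThresholdExit
open Summit.QuantumFields.BalabanUV.T4Continuum.CountSeamJunction
open Summit.QuantumFields.BalabanUV.T4Continuum.LateMergers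
open Summit.QuantumFields.BalabanUV.T4Continuum.HistoryFlow
open Summit.QuantumFields.BalabanUV.T4Continuum.HistoryRegeneration
open Summit.QuantumFields.BalabanUV.T4Continuum.HistoryTables
open Summit.QuantumFields.BalabanUV.T4Continuum.HistoryAssemblyTrees
open Summit.QuantumFields.BalabanUV.T4Continuum.HistorySocketTH
open Summit.QuantumFields.BalabanUV.T4Continuum.HistoryAssemblyTerms
open Summit.QuantumFields.BalabanUV.T4Continuum.HistoryBankingLE
open Summit.QuantumFields.BalabanUV.T4Continuum.HistoryCanonLE
open Summit.QuantumFields.BalabanUV.T4Continuum.HistoryExitLE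
open Summit.QuantumFields.BalabanUV.T4Continuum.HistoryAssemblyTreesLE

namespace Summit.QuantumFields.BalabanUV.T4Continuum.HistoryAssemblyTermsLE

noncomputable section

/-! ## §1 The per-term reading in the LE currency and the four tree-slot binders -/

section Binders

variable {ε γ ι : Type*} [DecidableEq γ] [DecidableEq ε]

/-- **THE PER-TERM READING OF THE LIVE STRUCTURES, LE CURRENCY** (= `HistoryAssemblyTerms.TermReading` with
`consistent` over `ConsistentTLE` and `wf` in place of `fresh`; a hypothesis SHAPE, the H3∕(ID) supplier's obligations in
term-keyed form; discharged by rows S3∕S4∕S5∕S7 for the members of admissible histories).  For every cutoff `K ≥ K₀`,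
every BAD term `τ ∈ T K` (an old live member) and every live member `(z, G′) ∈ mem K τ`: `G′` is a `ConsistentTLE`,
WELL-FORMED,
PENDING tagged genealogy, its root cell is a cell of the root's age, it is CHRONOLOGICAL within the caps (birth classes
`< Dcap K`, fuel `≤ Ncap K`); and WITHIN ONE TERM distinct members sit at distinct tree slots (disjoint regions have
distinct root cells). [folklore] -/
structure TermReadingLE (sh : ε → PEv) (C : T4PrintedShapeBanking.Consts) (Cell : ℕ → ℕ → Finset γ)
    (Dcap Ncap : ℕ → ℕ) (jstar : ℕ → ℕ) (K₀ : ℕ) (R : ℕ → ℕ → ℕ) (T : ℕ → Finset ι)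
    (mem : ℕ → ι → Finset (γ × Gen ε)) : Prop where
  /-- members are consistent tagged genealogies of their cutoff -/
  consistent : ∀ K, K₀ ≤ K → ∀ τ ∈ badTerms mem jstar T K, ∀ q ∈ mem K τ, ConsistentTLE sh C K (R K) q.2
  /-- members are well formed for the run's table (distinct tags, renewals while pending, partners alive together) -/
  wf : ∀ K, K₀ ≤ K → ∀ τ ∈ badTerms mem jstar T K, ∀ q ∈ mem K τ, q.2.WF (dictWT sh (R K) C.n₁)
  /-- members are pending at the cutoff -/
  pending : ∀ K, K₀ ≤ K → ∀ τ ∈ badTerms mem jstar T K, ∀ q ∈ mem K τ, K < q.2.reach (dictWT sh (R K) C.n₁)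
  /-- the root cell is a cell of the root's age -/
  cell_mem : ∀ K, K₀ ≤ K → ∀ τ ∈ badTerms mem jstar T K, ∀ q ∈ mem K τ, q.1 ∈ Cell K (K - q.2.rootStep)
  /-- members are chronological -/
  chrono : ∀ K, K₀ ≤ K → ∀ τ ∈ badTerms mem jstar T K, ∀ q ∈ mem K τ, T4CanonicalMenus.Chrono (PEv.step ∘ sh) q.2
  /-- birth classes below the class cap -/
  fat_lt : ∀ K, K₀ ≤ K → ∀ τ ∈ badTerms mem jstar T K, ∀ q ∈ mem K τ,
    ∀ e ∈ q.2.events, (sh e).kind = 0 → (sh e).fat < Dcap K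
  /-- fuel below the fuel cap -/
  fuel_le : ∀ K, K₀ ≤ K → ∀ τ ∈ badTerms mem jstar T K, ∀ q ∈ mem K τ, fuel q.2 ≤ Ncap K
  /-- within one term, distinct members occupy distinct tree slots -/
  inj : ∀ K, K₀ ≤ K → ∀ τ ∈ badTerms mem jstar T K, Set.InjOn (bslotOf sh) (mem K τ : Set (γ × Gen ε))

variable {sh : ε → PEv} {C : T4PrintedShapeBanking.Consts} {Cell : ℕ → ℕ → Finset γ} {Dcap Ncap : ℕ → ℕ}
  {jstar : ℕ → ℕ} {K₀ : ℕ} {R : ℕ → ℕ → ℕ} {T : ℕ → Finset ι} {mem : ℕ → ι → Finset (γ × Gen ε)}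
  {Λ' : ℝ} {g : ℕ → ℕ → ℝ}

/-- **`hlabTLE` FROM THE TERM READING (LE)**: at every slot the labelled price is `0` or the price of an occupant — a
`ConsistentTLE`, well-formed, pending tagged genealogy whose shape is the slot's tree (the arg-max member). [folklore] -/
theorem hlabTLE_of_termReadingLE (H : TermReadingLE sh C Cell Dcap Ncap jstar K₀ R T mem) (F' : ℕ → ℕ → Finset (Gen PEv))
    (K : ℕ) (hK : K₀ ≤ K) (j : ℕ) (_hj : j ≤ K) (z : γ) (_hz : z ∈ Cell K (K - j)) (Gs : Gen PEv)
    (_hG : Gs ∈ F' K j) :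
    yT sh C Λ' R g mem jstar T K j z Gs ≤ 0 ∨ ∃ G' : Gen ε, ConsistentTLE sh C K (R K) G' ∧ G'.WF (dictWT sh (R K) C.n₁) ∧
      K < G'.reach (dictWT sh (R K) C.n₁) ∧ relabel (shape ∘ sh) G' = Gs ∧
      yT sh C Λ' R g mem jstar T K j z Gs ≤ Λ' ^ partnerAges (PEv.step ∘ sh) G' *
        (Real.exp (-credits (credit C (g K) ∘ sh) G') *
          Real.exp (lifeCost (dictWT sh (R K) C.n₁) (costT sh C K (R K)) G')) := by
  by_cases h : (occ sh mem jstar T K ⟨j, z, Gs⟩).Nonempty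
  · obtain ⟨q, hq, heq⟩ := exists_occ_eq_yT (C := C) (Λ' := Λ') (R := R) (g := g) h
    obtain ⟨τ, hτ, hqτ, hs⟩ := mem_occ.1 hq
    obtain ⟨-, -, hrel⟩ := (bslotOf_eq_iff sh q j z Gs).1 hs
    refine Or.inr ⟨q.2, H.consistent K hK τ hτ q hqτ, H.wf K hK τ hτ q hqτ, H.pending K hK τ hτ q hqτ, hrel, ?_⟩
    rw [heq]; exact le_of_eq rfl
  · exact Or.inl (le_of_eq (yT_of_not_nonempty h))

/-- **`hstr` FROM THE TERM READING (LE)**: a bad class consists of LIVE tree slots of the canonical run family and contains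
an OLD one (leaf-02's `HistoryCanonLE.mem_bliveSlots_of_chronoLE` ∕ `mem_boldSlots_of_chronoLE`). [folklore] -/
theorem hstr_of_termReadingLE (H : TermReadingLE sh C Cell Dcap Ncap jstar K₀ R T mem) (K : ℕ) (hK : K₀ ≤ K)
    {c : Finset (BSlot γ PEv)} (hc : c ∈ badClasses sh mem jstar T K) :
    c ⊆ bliveSlots Cell (canonFam Dcap Ncap) K ∧ ∃ o ∈ boldSlots Cell (canonFam Dcap Ncap) jstar K, o ∈ c := by
  obtain ⟨τ, hτ, rfl⟩ := mem_badClasses.1 hc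
  refine ⟨fun s hs => ?_, ?_⟩
  · obtain ⟨q, hq, rfl⟩ := mem_image.1 hs
    exact mem_bliveSlots_of_chronoLE Cell (H.consistent K hK τ hτ q hq) (H.chrono K hK τ hτ q hq)
      (H.fat_lt K hK τ hτ q hq) (H.fuel_le K hK τ hτ q hq) (H.cell_mem K hK τ hτ q hq)
  · obtain ⟨-, q, hq, hold⟩ := mem_badTerms.1 hτ
    exact ⟨bslotOf sh q, mem_boldSlots_of_chronoLE Cell jstar (H.consistent K hK τ hτ q hq) (H.chrono K hK τ hτ q hq)
      (H.fat_lt K hK τ hτ q hq) (H.fuel_le K hK τ hτ q hq) (H.cell_mem K hK τ hτ q hq) hold,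
      mem_image_of_mem _ hq⟩

/-- **`hF` FROM A PER-TERM PRICE READING (LE reading; same proof)**: if the live price `F·Rf` of the class of every bad term is below the PRODUCT
of its members' tree-slot prices, then it is below the family weight of the class at the labelled price (`prod_image`
along within-term injectivity, factorwise `priceT ≤ yT`). [folklore] -/
theorem hF_of_priceReadingLE (H : TermReadingLE sh C Cell Dcap Ncap jstar K₀ R T mem) (hΛ : 0 ≤ Λ') {l₀ : ℝ}
    {Fc Rf : ℕ → Finset (BSlot γ PEv) → ℝ}
    (hprice : ∀ K t, |t| ≤ l₀ → K₀ ≤ K → ∀ τ ∈ badTerms mem jstar T K,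
      Fc K (bstrOf sh mem K τ) * Rf K (bstrOf sh mem K τ) ≤ ∏ q ∈ mem K τ, priceT sh C Λ' R g K q)
    (K : ℕ) (t : ℝ) (ht : |t| ≤ l₀) (hK : K₀ ≤ K) :
    ∀ c ∈ badClasses sh mem jstar T K,
      Fc K c * Rf K c ≤ famWeight (bslotPrice (yT sh C Λ' R g mem jstar T K)) c := by
  intro c hc
  obtain ⟨τ, hτ, rfl⟩ := mem_badClasses.1 hc
  refine (hprice K t ht hK τ hτ).trans ?_
  rw [famWeight, bstrOf, prod_image (H.inj K hK τ hτ)]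
  refine prod_le_prod (fun q _ => priceT_nonneg sh C hΛ R g K q) fun q hq => ?_
  simp only [bslotOf, bslotPrice]
  exact priceT_le_yT hτ hq

end Binders

/-! ## §2 The END statement: the LE exit ∘ seam with the term reading plugged -/

section End

variable {F : T4Family} {G : Type*} [GaugeGroup G] [MeasurableSpace G] [HaarData G] [RegularGaugeGroup G]
variable {ε : Type*} [DecidableEq ε]
variable {ι : Type*} [DecidableEq ι] {l₀ vol : ℝ} {K₀ : ℕ} {T : ℕ → Finset ι} {A A' shA shB : ℕ → ℝ → ι → ℝ}
  {dead dead' : ℕ → ℝ → ι → ℝ} {nup mup : ℕ → ℝ → ℝ} {Nup : ℝ}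
  {Cc Rr CcRec RrRec : ℕ → ℝ → ι → ℝ} {ν u s₂ q₀ r s Wsh : ℕ → ℝ}

/-- **NE7b's COUNT EXIT WITH THE LIVE STRUCTURES READ PER TERM, LE CURRENCY.**
`HistoryAssemblyTerms.hybridNE7_of_termReading_canon` VERBATIM except `H : TermReadingLE …` (members `ConsistentTLE` and
well formed — NO renewal-at-reach clause) and `hir : irThresholdTLE C F.L rr β₀ ≤ log g⁻²` (constants only); composed
over `HistoryAssemblyTreesLE.hybridNE7_of_treeBinders_canonLE` with `π K τ := bstrOf sh mem K τ`, bad classes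
`badClasses sh mem jhalf T K`, `bad_subset` PROVED, labelled price `yT`, `str K c := c`, and the four tree-slot binders
PROVED from `H` and the per-term price readings `hprice`∕`hprice′`.  Still displayed: constants (+ two largeness
conditions), flow side (⇐ BetaPertH), tuning, the (2.5) side condition, the (B) side, the `Regeneration` numerator
fields per run over the defined classes, the seam data. [folklore] -/
theorem hybridNE7_of_termReadingLE_canon (D : FiniteEpsData F G) (sh : ε → PEv) {C : T4PrintedShapeBanking.Consts}
    {rr : ℕ} {β₀ : ℝ} (h : ThresholdOK C F.L rr β₀) (hμ : 0 < C.μ) (d n : ℕ) (Dcap Ncap : ℕ → ℕ)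
    (hκ₁ : (d : ℝ) * Real.log F.L + 2 * Real.log 2 ≤ C.κ₁) (hE₀ : Real.log (2 + birthMass C) ≤ C.E₀)
    -- the flow side (⇐ BetaPertH, displayed) and tuning
    {γ₀ γb b β' : ℝ} {pe : ℕ} (hb : 0 ≤ b) (hlo : FlowStep.BetaLowerH b γ₀ D.βfun)
    (hhi : FlowStep.BetaUpperH β' γ₀ D.βfun) (hγ : γb ≤ γ₀) (hγβ : γb ^ 2 * β' < 1)
    (S : B14FlowStep.SmallnessFor γb β' β₀ F.L pe) (hp₀ : C.p₀ ≤ pe) (hrr : rr ≤ pe)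
    {g : ℝ} {g₀ : ℕ → ℝ} (ht : D.Tuned γb g g₀)
    (hir : irThresholdTLE C F.L rr β₀ ≤ Real.log (g ^ 2)⁻¹)
    -- the (B) side
    (hsign : B16.SignConventions D.C) {γB : ℝ} {em ep : ℝ → ℝ} (hcor : B16.Cor3With D.C γB em ep) (hγB : γb ≤ γB)
    {obs : (K : ℕ) → GaugeField (F.P K) 0 G → ℝ} {B : ℝ}
    (hobs : ∀ K, Measurable (obs K)) (hbd : ∀ K U, |obs K U| ≤ B)
    (hα : ∀ K t, |t| ≤ l₀ → K₀ ≤ K →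
      ∫ U, Real.exp (t * obs K U) * D.dens K (g₀ K) 0 U ∂fieldMeasure (F.P K) 0 G ≤ ∑ τ ∈ T K, A K t τ)
    (hα' : ∀ K t, |t| ≤ l₀ → K₀ ≤ K →
      ∫ U, Real.exp (t * obs (K + 1) U) * D.dens (K + 1) (g₀ (K + 1)) 0 U ∂fieldMeasure (F.P (K + 1)) 0 G ≤
        ∑ τ ∈ T K, A' K t τ)
    {c₀ n₁ : ℝ} (hc₀ : 0 < c₀) (hfloor : ∀ K, K₀ ≤ K → c₀ ≤ smallFieldMass D K (g₀ K))
    (hfloor' : ∀ K, K₀ ≤ K → c₀ ≤ smallFieldMass D (K + 1) (g₀ (K + 1)))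
    (hsites : ∀ K, K₀ ≤ K → ((D.C ⟨K, F.m, g₀ K⟩).numSites K : ℝ) ≤ n₁)
    (hsites' : ∀ K, K₀ ≤ K → ((D.C ⟨K + 1, F.m, g₀ (K + 1)⟩).numSites (K + 1) : ℝ) ≤ n₁)
    (hNup : 0 ≤ Nup) (hnup : ∀ K t, |t| ≤ l₀ → K₀ ≤ K → 0 ≤ nup K t ∧ nup K t ≤ Nup)
    (hmup : ∀ K t, |t| ≤ l₀ → K₀ ≤ K → 0 ≤ mup K t ∧ mup K t ≤ Nup)
    -- the (2.5) side condition on the size function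
    (R : ℕ → ℕ → ℕ) (hR : ∀ K s, s ≤ K → B14.IsRj F.L rr ((D.C ⟨K, F.m, g₀ K⟩).flow.g s) (R K s))
    -- H3, PER TERM: the live members of the terms and their reading
    (mem : ℕ → ι → Finset ((Fin d → ℕ) × Gen ε))
    (H : TermReadingLE sh C (cellN d n F.L) Dcap Ncap jhalf K₀ R T mem)
    {Fc Rf Fc' Rf' : ℕ → Finset (BSlot (Fin d → ℕ) PEv) → ℝ}
    (hprice : ∀ K t, |t| ≤ l₀ → K₀ ≤ K → ∀ τ ∈ badTerms mem jhalf T K,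
      Fc K (bstrOf sh mem K τ) * Rf K (bstrOf sh mem K τ) ≤
        ∏ q ∈ mem K τ, priceT sh C ((F.L : ℝ) ^ d) R (fun K => (D.C ⟨K, F.m, g₀ K⟩).flow.g) K q)
    (hprice' : ∀ K t, |t| ≤ l₀ → K₀ ≤ K → ∀ τ ∈ badTerms mem jhalf T K,
      Fc' K (bstrOf sh mem K τ) * Rf' K (bstrOf sh mem K τ) ≤
        ∏ q ∈ mem K τ, priceT sh C ((F.L : ℝ) ^ d) R (fun K => (D.C ⟨K, F.m, g₀ K⟩).flow.g) K q)
    -- H3: the remaining `Regeneration` numerator readings, over the DEFINED classes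
    (up : ∀ K t, |t| ≤ l₀ → K₀ ≤ K → ∀ c ∈ badClasses sh mem jhalf T K, ∀ τ ∈ fibre (bstrOf sh mem) T K c,
      A K t τ ≤ dead K t τ * Fc K c * nup K t)
    (dead_nonneg : ∀ K t, |t| ≤ l₀ → K₀ ≤ K → ∀ c ∈ badClasses sh mem jhalf T K,
      ∀ τ ∈ fibre (bstrOf sh mem) T K c, 0 ≤ dead K t τ)
    (resum : ∀ K t, |t| ≤ l₀ → K₀ ≤ K → ∀ c ∈ badClasses sh mem jhalf T K,
      ∑ τ ∈ fibre (bstrOf sh mem) T K c, dead K t τ ≤ Rf K c)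
    (F_nonneg : ∀ K t, |t| ≤ l₀ → K₀ ≤ K → ∀ c ∈ badClasses sh mem jhalf T K, 0 ≤ Fc K c)
    (up' : ∀ K t, |t| ≤ l₀ → K₀ ≤ K → ∀ c ∈ badClasses sh mem jhalf T K, ∀ τ ∈ fibre (bstrOf sh mem) T K c,
      A' K t τ ≤ dead' K t τ * Fc' K c * mup K t)
    (dead'_nonneg : ∀ K t, |t| ≤ l₀ → K₀ ≤ K → ∀ c ∈ badClasses sh mem jhalf T K,
      ∀ τ ∈ fibre (bstrOf sh mem) T K c, 0 ≤ dead' K t τ)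
    (resum' : ∀ K t, |t| ≤ l₀ → K₀ ≤ K → ∀ c ∈ badClasses sh mem jhalf T K,
      ∑ τ ∈ fibre (bstrOf sh mem) T K c, dead' K t τ ≤ Rf' K c)
    (F'_nonneg : ∀ K t, |t| ≤ l₀ → K₀ ≤ K → ∀ c ∈ badClasses sh mem jhalf T K, 0 ≤ Fc' K c)
    -- the seam's other inputs
    (hSh : ShellWeightBound l₀ T A A' shA shB Wsh)
    (hTB : ReindexedBudget l₀ vol T (fun K t τ => A K t τ - shA K t τ) (fun K t τ => A' K t τ - shB K t τ)
      (badOfClass (bstrOf sh mem) T (fun K _ => badClasses sh mem jhalf T K)) Cc Rr CcRec RrRec ν u s₂ q₀ r s)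
    (hr : Summable r) (hu : Summable u) (hs : Summable s) (hs₂ : Summable s₂) :
    ∃ K₁ K₂, K₀ ≤ K₁ ∧ HybridNE7 l₀ vol (fun K => T (K₁ + (K₂ + K))) (fun K => A (K₁ + (K₂ + K)))
      (fun K => A' (K₁ + (K₂ + K)))
      (fun K => badOfClass (bstrOf sh mem) T (fun K _ => badClasses sh mem jhalf T K) (K₁ + (K₂ + K)))
      (fun K => constOf l₀ B (max (em g) 0) n₁ c₀ Nup *
        recordsBudget (birthMass C) C.κ₁ ((n : ℝ) ^ d) ((F.L : ℝ) ^ d) (Real.log 2) jhalf (K₁ + (K₂ + K)))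
      (fun K => shA (K₁ + (K₂ + K))) (fun K => shB (K₁ + (K₂ + K))) (fun K => Wsh (K₁ + (K₂ + K)))
      (fun K => (r (K₁ + (K₂ + K)) + u (K₁ + (K₂ + K))) + (s (K₁ + (K₂ + K)) + s₂ (K₁ + (K₂ + K)))) := by
  have hLpos : (0 : ℝ) < F.L := by exact_mod_cast (lt_of_lt_of_le (by norm_num) (two_le_L F))
  have hΛ : (0 : ℝ) ≤ (F.L : ℝ) ^ d := pow_nonneg hLpos.le d
  exact hybridNE7_of_treeBinders_canonLE D sh h hμ d n Dcap Ncap hκ₁ hE₀ hb hlo hhi hγ hγβ S hp₀ hrr ht hir hsign hcor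
    hγB hobs hbd hα hα' hc₀ hfloor hfloor' hsites hsites' hNup hnup hmup
    (π := bstrOf sh mem) (Bad' := fun K _ => badClasses sh mem jhalf T K)
    (fun K _ _ _ => badClasses_subset_classIndex sh mem jhalf T K) up dead_nonneg resum F_nonneg up' dead'_nonneg
    resum' F'_nonneg R hR (yT sh C ((F.L : ℝ) ^ d) R (fun K => (D.C ⟨K, F.m, g₀ K⟩).flow.g) mem jhalf T)
    (fun K j _ z _ Gs _ => yT_nonneg hΛ K j z Gs)
    (fun K hK j hj z hz Gs hGs => hlabTLE_of_termReadingLE H (canonFam Dcap Ncap) K hK j hj z hz Gs hGs)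
    (fun _ c => c) (fun K t _ _ => Set.injOn_id _)
    (fun K t _ hK c hc => hstr_of_termReadingLE H K hK hc)
    (fun K t ht hK => hF_of_priceReadingLE H hΛ hprice K t ht hK)
    (fun K t ht hK => hF_of_priceReadingLE H hΛ hprice' K t ht hK) hSh hTB hr hu hs hs₂

end End

end

end Summit.QuantumFields.BalabanUV.T4Continuum.HistoryAssemblyTermsLE
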